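import Summits.MatrixMultiplication.MatrixMultiplication.Theorems.GradedDesignFamily.Negative.SubfieldCellNineRowThreeCert

/-!
# Subfield cell `GL₂(𝔽₉) ⊃ SL₂(𝔽₃)` at level one — VII-b: the row-three certificate, second part and its matrix-world reading

**Honest framing.** VALUE = a kernel-checked finite certificate about ONE finite cell of ONE
skeleton line (`quadratic_extension_level_one_cell`, stub S3 `stub_subfieldCell`, crux
`GradedDesignFamily`, route `LevelGradedCohnUmans`).  It is **not** progress on
`Summit.MatrixMultiplication` and does **not** refute `stub_subfieldCell`.

`fact_row3b` finishes the check of file VII (`checkRep` on the representatives `270 … 542`),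
`fact_row3` combines both halves, and `row3_alternatives` reads the certificate back in the matrix
world: for invertible `a, b ∈ M₂(𝔽₉)` with `mc a ∈ repsC` and `W = sixM a b` (the six quotients
`a, a⁻¹, b, b⁻¹, ab⁻¹, ba⁻¹`), one of the alternatives dead / tri / pool of file VII holds, stated with
the exact λ-vector codes `vc` of file II.  File VIII (`SubfieldCellNineRowThree`) turns this into
`|Y| ≥ 3 ⇒ |Z| ≤ 16`.
-/

set_option linter.dupNamespace false

namespace Summit.MatrixMultiplication.MatrixMultiplication.Theorems.GradedDesignFamily.Negative.SubfieldNine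

open Matrix

/-- **The certificate, second part.** `checkRep` holds for the representatives `270 … 542`. -/
theorem fact_row3b : ((repsC.drop 270).all checkRep) = true := by
  native_decide

/-- **The certificate.** `checkRep` holds for every class representative. -/
theorem fact_row3 : (repsC.all checkRep) = true :=
  List.all_eq_true.mpr fun x hx => by
    rw [← List.take_append_drop 270 repsC, List.mem_append] at hx
    rcases hx with h | h
    · exact List.all_eq_true.mp fact_row3a x h
    · exact List.all_eq_true.mp fact_row3b x h

/-! ### Reading the certificate in the matrix world -/

/-- the six quotients as matrices (`k ≥ 5 ↦ ba⁻¹`) -/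
def sixM (a b : Mat) : ℕ → Mat
  | 0 => a
  | 1 => inv2 a
  | 2 => b
  | 3 => inv2 b
  | 4 => mul2 a (inv2 b)
  | _ => mul2 b (inv2 a)

/-- `inv2` of an invertible matrix is invertible. -/
theorem det2_inv2 (a : Mat) (ha : det2 a ≠ 0) : det2 (inv2 a) ≠ 0 := by
  intro h0
  have := congrArg Matrix.det (fact_inv2 a ha)
  rw [Matrix.det_mul, ← det2_eq, h0, zero_mul, Matrix.det_one] at this
  exact zero_ne_one this

/-- `mul2` of invertible matrices is invertible. -/
theorem det2_mul2 (a b : Mat) (ha : det2 a ≠ 0) (hb : det2 b ≠ 0) : det2 (mul2 a b) ≠ 0 := by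
  rw [mul2_eq, det2_eq, Matrix.det_mul]
  exact mul_ne_zero (by rwa [← det2_eq]) (by rwa [← det2_eq])

/-- The six quotients are invertible. -/
theorem det2_sixM {a b : Mat} (ha : det2 a ≠ 0) (hb : det2 b ≠ 0) : ∀ k, det2 (sixM a b k) ≠ 0
  | 0 => ha
  | 1 => det2_inv2 a ha
  | 2 => hb
  | 3 => det2_inv2 b hb
  | 4 => det2_mul2 _ _ ha (det2_inv2 b hb)
  | _ + 5 => det2_mul2 _ _ hb (det2_inv2 a ha)

/-- Codes of the six quotients. -/
theorem sixF_mc {a b : Mat} (ha : det2 a ≠ 0) (hb : det2 b ≠ 0) (k : ℕ) :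
    sixF (mc a) (invT (mc a)) (mc b) (invT (mc b)) (mulT (mc a) (invT (mc b)))
      (mulT (mc b) (invT (mc a))) k = mc (sixM a b k) := by
  have h1 : invT (mc a) = mc (inv2 a) := by rw [invT_eq, mc_inv2 _ ha]
  have h2 : invT (mc b) = mc (inv2 b) := by rw [invT_eq, mc_inv2 _ hb]
  have h3 : mulT (mc a) (mc (inv2 b)) = mc (mul2 a (inv2 b)) := by rw [mulT_eq, mc_mul2]
  have h4 : mulT (mc b) (mc (inv2 a)) = mc (mul2 b (inv2 a)) := by rw [mulT_eq, mc_mul2]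
  rw [h1, h2, h3, h4]
  match k with
  | 0 => rfl
  | 1 => rfl
  | 2 => rfl
  | 3 => rfl
  | 4 => rfl
  | _ + 5 => rfl

/-- `vc = vcN ∘ mc` as functions. -/
theorem vc_eq (g : Mat) : vc g = vcN (mc g) := funext (fact_vc g)

/-- `1` is invertible. -/
theorem det2_one : det2 (1 : Mat) ≠ 0 := by rw [det2_eq, Matrix.det_one]; exact one_ne_zero

/-- Soundness of the triangular witness search. -/
theorem triB_sound {W : ℕ → MC} {D S : Array ℕ} (h : triB W D S = true) :
    ∃ ku kv kx : ℕ, dki (W ku) ≠ dki (W kv) ∧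
      ∃ i, (vcN (W kx) i).isSome ∧ vcN (W ku) i = none ∧ vcN (W kv) i = none := by
  simp only [triB, List.any_eq_true, Bool.and_eq_true, bne_iff_ne, ne_eq, triAt,
    Option.isNone_iff_eq_none] at h
  obtain ⟨uv, -, -, ix, -, -, hne, ⟨hx, hu⟩, hv⟩ := h
  exact ⟨uv.1, uv.2, ix, hne, _, hx, hu, hv⟩

/-- Soundness of the two-directions test. -/
theorem twoDirB_sound {W : ℕ → MC} (h : twoDirB W = true) : ∃ ku kv : ℕ, dki (W ku) ≠ dki (W kv) := by
  simp only [twoDirB, List.any_eq_true, bne_iff_ne, ne_eq] at h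
  obtain ⟨uv, -, hne⟩ := h
  exact ⟨uv.1, uv.2, hne⟩

/-- Soundness of the escape test. -/
theorem escB_sound {W : ℕ → MC} {cl : ℕ} {zc : MC} (h : escB W cl zc = true) :
    ∃ k i, (vcN (mulC (W k) zc) i).isSome ∧ cl.testBit (posI i) = false := by
  simp only [escB, List.any_eq_true, Bool.and_eq_true, Bool.not_eq_true'] at h
  obtain ⟨k, -, -, i, -, hi, hcl⟩ := h
  exact ⟨k, i, by rw [← mulT_eq, ← fact_sp]; exact hi, hcl⟩

/-- Soundness of the pool certificate. -/
theorem poolWith_sound {W : ℕ → MC} {cl : ℕ} {i₀ : Idx} (h : poolWith W cl i₀ = true) :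
    ∃ P : Idx → Prop, (∀ k < 6, ∀ i, (vcN (W k) i).isSome → P i) ∧ ¬ P i₀ ∧
    ∀ zc : MC, detC zc ≠ 0 → (∃ k i, (vcN (mulC (W k) zc) i).isSome ∧ ¬ P i) ∨ vcN zc i₀ = none := by
  simp only [poolWith, Bool.and_eq_true, Bool.not_eq_true', coversB, List.all_eq_true,
    Bool.or_eq_true, beq_iff_eq, List.mem_range] at h
  obtain ⟨⟨hcov, hi₀⟩, hall⟩ := h
  refine ⟨fun i => cl.testBit (posI i) = true, fun k hk i hi => ?_,
    show ¬ cl.testBit (posI i₀) = true by rw [hi₀]; exact Bool.false_ne_true, fun zc hzc => ?_⟩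
  · have := hcov k hk i (mem_allIdx i)
    rw [hi] at this; simpa using this
  · rcases hall zc (mem_allMC zc) with (h0 | hesc) | htg
    · exact absurd h0 hzc
    · obtain ⟨k, i, hi, hcl⟩ := escB_sound hesc
      exact Or.inl ⟨k, i, hi, show ¬ cl.testBit (posI i) = true by rw [hcl]; exact Bool.false_ne_true⟩
    · right
      have := fact_sp zc i₀
      rw [htg] at this
      exact Option.not_isSome_iff_eq_none.mp (by rw [← this]; exact Bool.false_ne_true)

/-- `sixM a b k` only depends on `min k 5`. -/
theorem sixM_of_ge {a b : Mat} : ∀ k, 5 ≤ k → sixM a b k = sixM a b 5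
  | _ + 5, _ => rfl

/-- **The three alternatives**, in the matrix world: for invertible `a, b` with `mc a ∈ repsC`,
with `W = sixM a b`, either (dead) some `W k` is λ-proportional to `1`, or (tri) there are
`W kᵤ ≁ W kᵥ` and a coordinate where `W kₓ` is supported and `W kᵤ, W kᵥ` vanish, or (pool)
`W kᵤ ≁ W kᵥ` and a predicate `P` on coordinates containing all supports of the `W k`, a coordinate
`i₀ ∉ P`, such that every invertible `z` has some `W k · z` supported outside `P` or has `λ_z(i₀) = 0`. -/
theorem row3_alternatives (a b : Mat) (ha : det2 a ≠ 0) (hb : det2 b ≠ 0) (hrep : mc a ∈ repsC) :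
    (∃ k, kprop (vc (sixM a b k)) (vc 1)) ∨
    (∃ ku kv kx, ¬ kprop (vc (sixM a b ku)) (vc (sixM a b kv)) ∧
      ∃ i, vc (sixM a b kx) i ≠ none ∧ vc (sixM a b ku) i = none ∧ vc (sixM a b kv) i = none) ∨
    ((∃ ku kv, ¬ kprop (vc (sixM a b ku)) (vc (sixM a b kv))) ∧ ∃ P : Idx → Prop, ∃ i₀ : Idx,
      (∀ k i, vc (sixM a b k) i ≠ none → P i) ∧ ¬ P i₀ ∧
      ∀ z : Mat, det2 z ≠ 0 → (∃ k i, vc (mul2 (sixM a b k) z) i ≠ none ∧ ¬ P i) ∨ vc z i₀ = none) := by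
  have hdet := det2_sixM ha hb
  have hW := sixF_mc ha hb
  have hck : checkCore (mc a) (invT (mc a)) (mc b) = true := by
    have := List.all_eq_true.mp fact_row3 _ hrep
    simp only [checkRep, List.all_eq_true, Bool.or_eq_true, beq_iff_eq] at this
    exact (this _ (mem_allMC (mc b))).resolve_left (detC_mc b hb)
  have hdk : ∀ ku kv, ¬ dki (mc (sixM a b ku)) = dki (mc (sixM a b kv)) →
      ¬ kprop (vc (sixM a b ku)) (vc (sixM a b kv)) := by
    intro ku kv hne hk
    rw [vc_eq, vc_eq] at hk
    exact hne (dki_eq_of_kprop (detC_mc _ (hdet ku)) (detC_mc _ (hdet kv)) hk)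
  simp only [checkCore, Bool.or_eq_true, Bool.and_eq_true, List.any_eq_true, beq_iff_eq] at hck
  rcases hck with ⟨k, -, hd⟩ | htri | ⟨htwo, hpool⟩
  · left
    refine ⟨k, ?_⟩
    rw [hW] at hd
    rw [vc_eq, vc_eq, mc_one]
    exact kprop_of_dki (detC_mc _ (hdet k)) (by rw [← mc_one]; exact detC_mc 1 det2_one) hd
  · right; left
    obtain ⟨ku, kv, kx, hne, i, hx', hu', hv'⟩ := triB_sound htri
    rw [hW, hW] at hne; rw [hW] at hx' hu' hv'
    refine ⟨ku, kv, kx, hdk ku kv hne, i, ?_, ?_, ?_⟩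
    · rw [vc_eq]; exact Option.isSome_iff_ne_none.mp hx'
    · rw [vc_eq]; exact hu'
    · rw [vc_eq]; exact hv'
  · right; right
    obtain ⟨ku, kv, hne⟩ := twoDirB_sound htwo
    rw [hW, hW] at hne
    obtain ⟨P, hcov, hi₀, hall⟩ := poolWith_sound hpool
    refine ⟨⟨ku, kv, hdk ku kv hne⟩, P, _, fun k i hi => ?_, hi₀, fun z hz => ?_⟩
    · have hk : sixM a b k = sixM a b (min k 5) := by
        rcases le_or_gt 5 k with h5 | h5
        · rw [Nat.min_eq_right h5]; exact sixM_of_ge k h5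
        · rw [Nat.min_eq_left (le_of_lt h5)]
      rw [hk, vc_eq, ← hW] at hi
      exact hcov (min k 5) (by omega) i (Option.isSome_iff_ne_none.mpr hi)
    · rcases hall (mc z) (detC_mc z hz) with ⟨k, i, hi, hP⟩ | hnone
      · left
        refine ⟨k, i, ?_, hP⟩
        rw [vc_eq, mc_mul2, ← hW]; exact Option.isSome_iff_ne_none.mp hi
      · right; rw [vc_eq]; exact hnone

end Summit.MatrixMultiplication.MatrixMultiplication.Theorems.GradedDesignFamily.Negative.SubfieldNine
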